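import Literature.NumberTheory.GaloisCohomology.KummerClassLocalPower     -- ★ Hensel `exists_eq_pow_of_valuation_sub_one_lt` (local field, `|n| = 1`) + the `Valued`∕`ValuativeRel` equivalence idiom
import Literature.NumberTheory.Automorphic.QuadraticLocalBaseChange        -- ★ `UnitaryGroup.ball_mem_nhds` (open balls of `E_w` are neighbourhoods)
import HarnessLib

/-!
# Every tame local square class has a global representative: `K_w(√d) = K_w(√m)` with `m ∈ K` — organ «LQC — K₁ AS A COMPLETION», brick (Q3)
# (Neukirch, *ANT*, Ch. II (3.4) density, (5.7) Hensel; Serre, *Local Fields*, Ch. XIV §4)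

Topic `NumberTheory/NumberFields`; namespace `Literature.NumberTheory.NumberFields`.  THEOREMS ONLY (no definition, no instance, no notation, no named fact, no `sorry`).  Cell
`pub/hodgecm-mathlib` (D-0151), crux H413 = `stmt-HodgeConjecture-24833`; road «S3-tree» (LEAD F0P3a-plan (g11) T10-38 «BOOK IT»), brick T3′ «DEPTH-ZERO κ-TRANSFER», population P-2
(W2 census F0P3a-p04 (g16) `CENSUS-T3prime-P2.addendum1` 1bdd60a2 §B: the two remaining type-(2) rows are gated on «K₁ = E_w(√disc) AS A COMPLETION»), infrastructure organ **«LQC»**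
(architect A-p16 (g29) A-80 (2) → F0P3-p02 (g14)).  HONEST LABEL: HC_CM is proved only modulo the printed citations (2 remaining named inputs hLiu418 24832, h413 24833) until rung 0
closes; this file is elementary local∕global number theory and asserts nothing printed.

THE MATHEMATICS.  `K` a number field, `w` a finite place, `K_w` its completion (Mathlib `HeightOneSpectrum.adicCompletion`, the tree's `Valued` + `ValuativeRel` + local-field instances).
Since `K` is dense in `K_w`, every `d ≠ 0` has a global `m` in the ball `|m − d|_w < |d|_w`; then `u := d⁻¹ m ≡ 1 (mod 𝔪_w)`, and when `|2|_w = 1` Hensel's lemma makes `u` a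
square.  Hence the local quadratic algebra `K_w[X]⁄(X² − d)` equals `K_w[X]⁄(X² − m)` — the completion at the (unique, brick (QP)) place above `w` of the GLOBAL quadratic field
`K(√m)` (brick (QM)), which is how the type-(2) splitting field `K₁ = E_w(√disc χ_g)` of T3′ acquires the tree's `adicCompletion` infrastructure (`𝒪`, `𝔪`, `𝓀`, `IsNonarchimedeanLocalField`,
`galAdicCompletionMap`).  Dyadic places (`|2|_w < 1`) are out of scope (road ruling T10-2: wild residue «S3-wild»); there the ball must shrink to `1 + 4𝔪_w`.

* `exists_algebraMap_valued_sub_lt`, **`exists_isSquare_inv_mul_coe`**.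

## References
* [Neukirch1999] J. Neukirch, *Algebraic Number Theory*, Grundlehren 322 (1999): Ch. II (3.4) (density of `K` in `K_w`), (5.7)–(5.8) (Hensel: principal units are powers).
* [SerreLocalFields1979] J.-P. Serre, *Local Fields*, GTM 67 (1979): Ch. XIV §4 (squares in local fields), Ch. II §3.
* [CasselsFrohlich1967] J. W. S. Cassels, A. Fröhlich (eds.), *Algebraic Number Theory* (1967): Ch. II §6 (approximation), §10 (completions of global fields).
-/

set_option autoImplicit false

noncomputable section

open NumberField IsDedekindDomain ValuativeRel Topology

namespace Literature.NumberTheory.NumberFields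


variable {K : Type} [Field K] [NumberField K] (w : HeightOneSpectrum (𝓞 K))

/-- **Weak approximation at one place**: every non-zero `d ∈ K_w` has a global `m ∈ K` with `|m − d|_w < |d|_w` (so `m ≠ 0` and `m ∕ d ≡ 1 (mod 𝔪_w)`):
`K` is dense in `K_w` (Mathlib `HeightOneSpectrum.denseRange_algebraMap`) and the ball is a neighbourhood (★ `ball_mem_nhds`). [cite: Neukirch1999, Ch. II (3.4)] -/
theorem exists_algebraMap_valued_sub_lt {d : w.adicCompletion K} (hd : d ≠ 0) :
    ∃ m : K, Valued.v (algebraMap K (w.adicCompletion K) m - d) < Valued.v d := by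
  have hnhds : {y : w.adicCompletion K | Valued.v (y - d) < Valued.v d} ∈ 𝓝 d :=
    Literature.NumberTheory.Automorphic.UnitaryGroup.ball_mem_nhds w d d (by simpa using hd)
  have hdense := HeightOneSpectrum.denseRange_algebraMap (K := K) w
  obtain ⟨y, hyU, ⟨m, rfl⟩⟩ := mem_closure_iff_nhds.1 (hdense d) _ hnhds
  exact ⟨m, hyU⟩

/-- **EVERY TAME LOCAL SQUARE CLASS HAS A GLOBAL REPRESENTATIVE.**  For a finite place `w` of the number field `K` with `|2|_w = 1` and `d ∈ K_w^×` there is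
`m ∈ K^×` with `d⁻¹ m` a square in `K_w` — hence `K_w(√d) = K_w(√m)` is the completion of the GLOBAL quadratic field `K(√m)` (the organ «LQC — K₁ as a completion»,
road «S3-tree» T3′ P-2).  Proof: pick `m` with `|m − d|_w < |d|_w` (`exists_algebraMap_valued_sub_lt`); then `|d⁻¹m − 1|_w < 1` and Hensel's lemma for `X² − u`, `|2| = 1`
(★ `Literature.NumberTheory.GaloisCohomology.exists_eq_pow_of_valuation_sub_one_lt`) makes `d⁻¹m` a square. [cite: Neukirch1999, Ch. II (5.7)] [cite: SerreLocalFields1979, Ch. XIV §4] -/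
theorem exists_isSquare_inv_mul_coe (h2 : Valued.v (2 : w.adicCompletion K) = 1) {d : w.adicCompletion K} (hd : d ≠ 0) :
    ∃ m : K, m ≠ 0 ∧ IsSquare (d⁻¹ * algebraMap K (w.adicCompletion K) m) := by
  obtain ⟨m, hm⟩ := exists_algebraMap_valued_sub_lt w hd
  have hvd : Valued.v d ≠ 0 := by simpa using hd
  have hm0 : m ≠ 0 := by
    rintro rfl
    rw [map_zero, zero_sub, Valuation.map_neg] at hm
    exact lt_irrefl _ hm
  refine ⟨m, hm0, ?_⟩
  set x : w.adicCompletion K := d⁻¹ * algebraMap K (w.adicCompletion K) m with hx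
  have hx1 : Valued.v (x - 1) < 1 := by
    have : x - 1 = d⁻¹ * (algebraMap K (w.adicCompletion K) m - d) := by
      rw [hx, mul_sub, inv_mul_cancel₀ hd]
    rw [this, map_mul, map_inv₀]
    calc (Valued.v d)⁻¹ * Valued.v (algebraMap K (w.adicCompletion K) m - d) < (Valued.v d)⁻¹ * Valued.v d :=
          mul_lt_mul_of_pos_left hm (inv_pos.2 (zero_lt_iff.2 hvd))
      _ = 1 := inv_mul_cancel₀ hvd
  -- transport to the valuative-relation valuation and apply Hensel (★ `exists_eq_pow_of_valuation_sub_one_lt`)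
  have heqv : (Valued.v : Valuation (w.adicCompletion K) _).IsEquiv (valuation (w.adicCompletion K)) := ValuativeRel.isEquiv _ _
  have h2' : valuation (w.adicCompletion K) ((2 : ℕ) : w.adicCompletion K) = 1 := by
    rw [← heqv.eq_one_iff_eq_one]; exact_mod_cast h2
  have hx1' : valuation (w.adicCompletion K) (x - 1) < 1 := by rwa [← heqv.lt_one_iff_lt_one]
  obtain ⟨t, ht⟩ := Literature.NumberTheory.GaloisCohomology.exists_eq_pow_of_valuation_sub_one_lt (w.adicCompletion K) 2 h2' hx1'
  exact ⟨t, by rw [ht, sq]⟩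

end Literature.NumberTheory.NumberFields

end
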